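import Summits.QuantumFields.YangMills.Theorems.BalabanUVNodesN15PerCubeGreenTwoGridGradientKnitDefectReg335HolderPairing
import Summits.QuantumFields.YangMills.Theorems.BalabanUVNodesN15PerCubeGreenTwoGridSpecPair
import Summits.QuantumFields.YangMills.Theorems.BalabanUVNodesN15PerCubeGreenNamedInverse
import HarnessLib

/-!
# N15 = NE2, road (c) — PROGRAMME (PC), (PC-E-J-N) 389J: THE TWO-GRID η-DEFECT OF THE GRADIENT ENTRY `D_U∘G′(U)` OF [B9] (3.42) FOR THE **NAMED** SCALAR COVARIANT GREEN's FUNCTIONS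
# `G′(U′) = (Δ_{R_U′} + a′Q′_TᵀQ′_T)⁻¹`, `G′(U) = (Δ_{R_U} + aQ′_TᵀQ′_T)⁻¹` FROM ONE Reg335-HÖLDER DATUM PER CUBE — n15-c∕416 (371J) with NO `∃ u′` and the displayed `r_V ≤ 1`
# DISCHARGED (dag-n15-c g36, n15-c∕417; v1.1: citation locators corrected per ref-J READ-751 ∕ ref-K (King (2.11) p.653, Averaging (9) p.18) — docstrings only, statement and proof byte-identical; v1.2 (dag-n15-a g40,
# owner-lane BUILD REPAIR while dag-n15-c g36 is parked on n15-c∕418): heartbeat budget of the one theorem 1 600 000 → 3 200 000 and NOTHING else — the hub `lake build` of v1∕v1.1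
# timed out deterministically «maximum number of heartbeats (1600000)» (ops-buildfix-1 T13–T16; gate build_batcher streams 41∕73 rc 1, 12:50Z–17:51Z 08-31, no olean ⇒ importers
# deferred `remote:incoherent`) although the farm check passes at 1.6 M; farm probes: FAILS at 1.4 M, passes at 1.6 M ⇒ the proof sits within 12 % of its budget and the build՚s process
# model crosses it; 3.2 M = 2× headroom. Statement, name, proof text and imports byte-identical to v1.1)

Cell `pub-ymgap`, seat `pub-ymgap-dag-n15-c` (generation g36; R134 (a) seat, strategy s1 «first missing estimate»; HUMAN RULING D-0062; chair R424 venue).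
`bears_on: R4∕N15 · K3⁸ SpineGivenEndpointR13SepCoPHV (stmt-QuantumFields-27366)`; filed `--kind proof --supports stmt-QuantumFields-27366 --as helper` — COUNT-NEUTRAL.
ONE theorem, 0 `def`, 0 `sorry`.  Imports BY NAME n15-c∕416 `…PerCubeGreenTwoGridGradientKnitDefectReg335HolderPairing` (its producer n15-c∕414 `uN_idef_covD_scGreen_tr` and its two
[folklore] geometry lemmas `sc_cell_tdist_le_of_mem`, `sc_hΩfwd_of_stepLetters_of_mem`), n15-c∕387 `…PerCubeGreenTwoGridSpecPair` (`uN_scGreen_specPair_tr`: the glued operators of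
the pair are two-sided inverses for the SAME gauges under the SAME hypotheses) and n15-c∕388 `…PerCubeGreenNamedInverse` (`scGreenOp`, `scGreenOp′`, `eq_scGreenOp(′)_of_inverse`).
Nothing in the tree is modified, no landed name re-declared; generator `tools/gf_pairing_J.py` (the body is 416's VERBATIM but for the six deltas listed below).

THE THEOREM `uN_idef_covD_scGreenOp_of_reg335Holder_pairing`: HYPOTHESES = n15-c∕416's VERBATIM MINUS `r_V ≤ 1` (one `Reg335HolderCube … ξ (η′·tdistT) C β Cβ` datum per cube on a
site set containing the five-block collar of the plateau; the direction `μ₀`; `rV oV o oB` with the explicit divergence-fit threshold and the numeric thresholds; the pairing-fit letter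
`o_a ≥` the explicit expression of n15-c∕415); CONCLUSION = 416's majorant `D·((L^k)^{−1∕4} + o + ((1+ρ)^{(d+1)(L^r−1)} − 1) + o_a)·e^{−(δ∕16)|y−y′|_T}` for the η-defect THROUGH THE
COVARIANT TRANSPORT `τ_{Ad∘U′}` of `D_{U′,μ₀} ∘ scGreenOp′ … (U′)` against `D_{U,μ₀} ∘ scGreenOp … (U)`, `U` = the straight fine holonomies of `U′` along King's block lines — THE
named inverses (n15-c∕388), with NO existential over gauges.  THE SIX DELTAS vs 416: (1) `obtain` n15-c∕387's constant block as well; (2) `w₀ := max`, `R₀ := min (min R₀ R₀A) 1`;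
(3) no `refine ⟨u′, hu′, ?_⟩`; (4) `r_V ≤ 1` is DERIVED from the threshold `hRle` (its left side dominates `r_V`, its right side is now `≤ 1`) instead of displayed; (5) 414 is applied
to a `have hmain`; (6) n15-c∕387 applied to the SAME gauges and letters gives the four inverse identities, and `rw [eq_scGreenOp'_of_inverse …, eq_scGreenOp_of_inverse …] at hmain`
removes the gauges (the rewrite acts under `D′∘`, `D∘`).

HONEST FRAMING ∕ LIMITS.  Bookkeeping + uniqueness of inverses over landed theorems; MODEL two-grid setting (King tori, straight-holonomy pairing, one cube scale `ξ`); the datum is the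
typed per-cube class ((3.35) + the Hölder member of [B11] Thm 1 (9) at one `β`) as a HYPOTHESIS; nothing of [B9]∕[B11] asserted.  The SHAPE of the gradient entry of [B9] (3.42) ∕
Thm 3.14 for `G′`, NOT the printed theorem.  NE2⁺ NOT PRINTED ∕ NOT proved; N15 of record untouched (DISCHARGED AS CONSUMED, p687738); K3⁸ OPEN; counts of record UNMOVED (typed
28∕28 · discharged 8∕27); one finite 𝕋⁴ at fixed ε per index — NOT infinite volume, NOT OS on ℝ⁴, NOT a mass gap, NOT Clay.  Restate-immune (no Theses import).
-/




set_option autoImplicit false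

noncomputable section

open scoped BigOperators Matrix Matrix.Norms.L2Operator
open Finset

namespace Summit.QuantumFields.YangMills.BalabanUVNodes.N15.Gluing

open Real
open Literature.MathematicalPhysics.QuantumFieldTheory.Balaban1983to89
open Literature.MathematicalPhysics.QuantumFieldTheory.Balaban1983to89.B5Prop11Plancherel (Tor fine unitVec)
open Literature.MathematicalPhysics.QuantumFieldTheory.Balaban1983to89.B11SectG (BlockNorm HasMaj)
open Literature.MathematicalPhysics.QuantumFieldTheory.Balaban1983to89.T4EtaRateDefect (idef)
open Literature.MathematicalPhysics.QuantumFieldTheory.Balaban1983to89.T4EtaRateCoeffDefect (pull)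
open Literature.MathematicalPhysics.QuantumFieldTheory.Balaban1983to89.B6Prop26Gluing (mulOp)
open Literature.MathematicalPhysics.QuantumFieldTheory.Balaban1983to89.B6UnitTorusCarrier (unitTorusGeo)
open Literature.MathematicalPhysics.QuantumFieldTheory.Balaban1983to89.B5SiteBridgeP12 (MP)
open Literature.MathematicalPhysics.QuantumFieldTheory.Balaban1983to89.B9Eq335RegularityClasses (Reg335Cube)
open Literature.MathematicalPhysics.QuantumFieldTheory.King1986 (aK)
open Literature.MathematicalPhysics.QuantumFieldTheory.King1986.Torus (blockOf tdistT tdistT_self)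
open Summit.QuantumFields.YangMills.BalabanUVNodes.N15KingModelRung.Curved (one_le_tdistT_of_ne)
open Literature.Barriers.QuantumFields (traceForm)
open Summit.QuantumFields.YangMills.BalabanUVNodes.N15.BackgroundLayer (tCoefA tCoefC)
open Summit.QuantumFields.YangMills.BalabanUVNodes.N15.VectorPiece (kingPr)
open Summit.QuantumFields.YangMills.BalabanUVNodes.N15.MatrixSpecies (coordMat basisConst basisConst_nonneg liftBlk liftMap covD)
open Summit.QuantumFields.YangMills.BalabanUVNodes.N15.CurvedSpecies (gaugePair Reg335HolderCube uN_exists_gauge_pairLetters_of_reg335HolderCube)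
open Summit.QuantumFields.YangMills.BalabanUVNodes.N15.CovAvg (mprod kingSec ctauS conjTranspose_mprod_mul_self norm_cellOsc_le)

variable {d : ℕ}

section Final

variable {L : ℕ} [NeZero L]

set_option maxHeartbeats 3200000 in
/-- ★★★ **THE TWO-GRID η-DEFECT OF THE GRADIENT ENTRY `D_U∘G′(U)` FOR THE NAMED SCALAR COVARIANT GREEN's FUNCTIONS FROM ONE `Reg335HolderCube` DATUM PER CUBE — n15-c∕416 WITHOUT
`∃ u′` and without the displayed `r_V ≤ 1`.**  See the module docstring.
[cite: Balaban1985BackgroundPropagators, (3.42) p.397, Thm 3.14 pp.426–427 (template), (3.24)–(3.25) p.394, (3.34)–(3.36) p.396, (3.50)–(3.52) p.400; Balaban1985Variational, Thm 1 (9) p.279 (the Hölder clause: shape);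
Balaban1985Averaging, (9) p.18, (124)–(125) p.36 (pairing: shape); King1986, (2.11) p.653 (block-spin pairing convention), p.664] -/
theorem uN_idef_covD_scGreenOp_of_reg335Holder_pairing (hL : Odd L ∧ 1 < L) (hL7 : 7 ≤ L) {a₀ : ℝ} (ha₀ : 0 < a₀) (ι : Type) [Fintype ι] [DecidableEq ι] (μ₀ : Fin (d + 1)) :
    ∃ δ w₀ R₀ D : ℝ, 0 < δ ∧ 0 < R₀ ∧ ∀ (mv kk r : ℕ), 1 ≤ kk → 1 ≤ r → w₀ ≤ ((L ^ mv : ℕ) : ℝ) →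
      ∀ {mm : Type} [Fintype mm] [DecidableEq mm] [Nonempty mm] (e : Matrix mm mm ℂ ≃L[ℝ] (ι → ℝ)), (∀ A B : Matrix mm mm ℂ, traceForm A B = e A ⬝ᵥ e B) →
      ∀ (U' : Fin (d + 1) → ScX' d L mv kk r hL → (Matrix mm mm ℂ)ˣ), (∀ μ x', (U' μ x' : Matrix mm mm ℂ) ∈ Matrix.unitaryGroup mm ℂ) →
      -- ONE datum ((3.35) + the Hölder clause of (9) at exponent `β`, η′-scale fine torus distance) per cube, on a site set containing the five-block collar of the plateau
      ∀ (Q : (Fin (d + 1) → ZMod (2 * L)) → Set (ScX' d L mv kk r hL)) (ξ C β Cβ : ℝ), 0 < ξ → 0 ≤ C → 0 ≤ β → 0 ≤ Cβ →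
        (∀ k, Reg335HolderCube (scShift' d L mv kk r hL) U' ((((L ^ r * L ^ kk : ℕ) : ℝ))⁻¹) (Q k) ξ (fun z z' => ((((L ^ r * L ^ kk : ℕ) : ℝ))⁻¹) * tdistT (fine (L ^ r * L ^ kk) (cvM d L mv kk hL)) z z') C β Cβ) →
        (∀ k z, (∃ y ∈ cvSk d L mv kk hL k, (unitTorusGeo L kk (cvM d L mv kk hL)).dist (scBlk' d L mv kk r hL z) y ≤ 5) → z ∈ Q k) →
      ∀ (rV oV o oB : ℝ), 0 ≤ rV → 0 ≤ oV → 0 ≤ oB →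
        -- the divergence fit: any number above the explicit `O(η^β) + O(η)` expression of n15-c∕369 at the datum's letters
        (@basisConst ι _ (Matrix mm mm ℂ) Matrix.frobeniusNormedAddCommGroup Matrix.frobeniusNormedSpace e * (((L ^ r * L ^ kk : ℕ) : ℝ) ^ 2 * (Fintype.card mm * (2 * (((((L ^ r * L ^ kk : ℕ) : ℝ))⁻¹) ^ 2 * ((Cβ * (ξ ^ (2 + β))⁻¹ * (2 * ((L ^ r : ℕ) : ℝ) * ((((L ^ r * L ^ kk : ℕ) : ℝ))⁻¹)) ^ β + 2 * ((((L ^ r * L ^ kk : ℕ) : ℝ))⁻¹) * ((C / ξ) * (C / ξ ^ 2))) * Real.exp (5 * (((((L ^ r * L ^ kk : ℕ) : ℝ))⁻¹) * (C / ξ))))) + ((((L ^ r * L ^ kk : ℕ) : ℝ))⁻¹) ^ 2 * ((C / ξ ^ 2) * Real.exp (((((L ^ r * L ^ kk : ℕ) : ℝ))⁻¹) * (C / ξ))) * (((d + 1 : ℕ) : ℝ) * (((L ^ r - 1 : ℕ) : ℝ) * (((((L ^ r * L ^ kk : ℕ) : ℝ))⁻¹) ^ 2 * ((C / ξ ^ 2)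 * Real.exp (((((L ^ r * L ^ kk : ℕ) : ℝ))⁻¹) * (C / ξ)))))) + (((((L ^ r * L ^ kk : ℕ) : ℝ))⁻¹) ^ 2 * ((C / ξ ^ 2) * Real.exp (((((L ^ r * L ^ kk : ℕ) : ℝ))⁻¹) * (C / ξ))) + (((d + 1 : ℕ) : ℝ) * (((L ^ r - 1 : ℕ) : ℝ) * (((((L ^ r * L ^ kk : ℕ) : ℝ))⁻¹) ^ 2 * ((C / ξ ^ 2) * Real.exp (((((L ^ r * L ^ kk : ℕ) : ℝ))⁻¹) * (C / ξ)))))) + ((((L ^ r * L ^ kk : ℕ) : ℝ))⁻¹) ^ 2 * ((C / ξ ^ 2) * Real.exp (((((L ^ r * L ^ kk : ℕ) : ℝ))⁻¹) * (C / ξ)))) * (((((L ^ r * L ^ kk : ℕ) : ℝ))⁻¹) ^ 2 * ((C / ξ ^ 2) * Real.exp (((((L ^ r * L ^ kk : ℕ) : ℝ))⁻¹) * (C / ξ)))))) + Fintype.card mm * (2 * ((L ^ kk : ℕ) : ℝ) ^ 2 * (2 * ((L ^ r : ℕ) : ℝ) ^ 3 * ((((((L ^ r * L ^ kk : ℕ)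 : ℝ))⁻¹) * ((C / ξ) * Real.exp (((((L ^ r * L ^ kk : ℕ) : ℝ))⁻¹) * (C / ξ)))) * (((((L ^ r * L ^ kk : ℕ) : ℝ))⁻¹) ^ 2 * ((C / ξ ^ 2) * Real.exp (((((L ^ r * L ^ kk : ℕ) : ℝ))⁻¹) * (C / ξ))))) + ((L ^ r : ℕ) : ℝ) ^ 2 * (((((L ^ r * L ^ kk : ℕ) : ℝ))⁻¹) ^ 2 * ((Cβ * (ξ ^ (2 + β))⁻¹ * (2 * ((L ^ r : ℕ) : ℝ) * ((((L ^ r * L ^ kk : ℕ) : ℝ))⁻¹)) ^ β + 2 * ((((L ^ r * L ^ kk : ℕ) : ℝ))⁻¹) * ((C / ξ) * (C / ξ ^ 2))) * Real.exp (5 * (((((L ^ r * L ^ kk : ℕ) : ℝ))⁻¹) * (C / ξ)))))) + 2 * (((L ^ r : ℕ) : ℝ) * ((L ^ kk : ℕ) : ℝ)) ^ 2 * ((((L ^ r : ℕ) : ℝ) + 1) * (((((L ^ r * L ^ kk : ℕ) : ℝ))⁻¹) * ((C / ξ) * Real.exp (((((L ^ r * L ^ kk : ℕ) : ℝ))⁻¹)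 * (C / ξ)))) * (((((L ^ r * L ^ kk : ℕ) : ℝ))⁻¹) ^ 2 * ((C / ξ ^ 2) * Real.exp (((((L ^ r * L ^ kk : ℕ) : ℝ))⁻¹) * (C / ξ)))))))) ≤ oB →
        -- numeric thresholds (the letters `p`, `q`, `Ω` written out)
        Fintype.card ι * (@basisConst ι _ (Matrix mm mm ℂ) Matrix.frobeniusNormedAddCommGroup Matrix.frobeniusNormedSpace e * (2 * Real.sqrt (Fintype.card mm)) * (Real.sqrt (Fintype.card mm) * (((1 + ((((L ^ r * L ^ kk : ℕ) : ℝ))⁻¹) * ((C / ξ) * Real.exp (((((L ^ r * L ^ kk : ℕ) : ℝ))⁻¹) * (C / ξ)))) ^ (L ^ r) - 1) / ((((L ^ kk : ℕ) : ℝ))⁻¹)))) ≤ rV →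
        Fintype.card ι * (Fintype.card (Fin (d + 1)) * (Fintype.card ι * (@basisConst ι _ (Matrix mm mm ℂ) Matrix.frobeniusNormedAddCommGroup Matrix.frobeniusNormedSpace e * (2 * Real.sqrt (Fintype.card mm)) * (Real.sqrt (Fintype.card mm) * (((1 + ((((L ^ r * L ^ kk : ℕ) : ℝ))⁻¹) * ((C / ξ) * Real.exp (((((L ^ r * L ^ kk : ℕ) : ℝ))⁻¹) * (C / ξ)))) ^ (L ^ r) - 1) / ((((L ^ kk : ℕ) : ℝ))⁻¹)))) ^ 2 + (@basisConst ι _ (Matrix mm mm ℂ) Matrix.frobeniusNormedAddCommGroup Matrix.frobeniusNormedSpace e * (2 * Real.sqrt (Fintype.card mm)) * (Real.sqrt (Fintype.card mm) * (((C / ξ ^ 2) * Real.exp (((((L ^ r * L ^ kk : ℕ) : ℝ))⁻¹) * (C / ξ))) * (1 + ((((L ^ r * L ^ kk : ℕ) : ℝ))⁻¹) * ((C / ξ) * Real.exp (((((L ^ r * L ^ kk : ℕ) : ℝ))⁻¹) * (C / ξ)))) ^ (L ^ r)))))) ≤ rV →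
        Fintype.card ι * (((L ^ r * L ^ kk : ℕ) : ℝ) * (@basisConst ι _ (Matrix mm mm ℂ) Matrix.frobeniusNormedAddCommGroup Matrix.frobeniusNormedSpace e * (2 * Real.sqrt (Fintype.card mm)) * (Real.sqrt (Fintype.card mm) * ((((d + 1 : ℕ) : ℝ) * ((L ^ r - 1 : ℕ) : ℝ) + (L ^ r : ℕ) + 1) * (((((L ^ r * L ^ kk : ℕ) : ℝ))⁻¹) ^ 2 * ((C / ξ ^ 2) * Real.exp (((((L ^ r * L ^ kk : ℕ) : ℝ))⁻¹) * (C / ξ)))))) + ((1 + Fintype.card ι * (((((L ^ r * L ^ kk : ℕ) : ℝ))⁻¹) * (@basisConst ι _ (Matrix mm mm ℂ) Matrix.frobeniusNormedAddCommGroup Matrix.frobeniusNormedSpace e * (2 * Real.sqrt (Fintype.card mm)) * (Real.sqrt (Fintype.card mm) * (((1 + ((((L ^ r * L ^ kk : ℕ) : ℝ))⁻¹) * ((C / ξ) * Real.exp (((((L ^ r * L ^ kk : ℕ) : ℝ))⁻¹) * (C / ξ)))) ^ (L ^ r) - 1) / ((((L ^ kk : ℕ) : ℝ))⁻¹))))))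 ^ (L ^ r) - 1) * (((((L ^ r * L ^ kk : ℕ) : ℝ))⁻¹) * (@basisConst ι _ (Matrix mm mm ℂ) Matrix.frobeniusNormedAddCommGroup Matrix.frobeniusNormedSpace e * (2 * Real.sqrt (Fintype.card mm)) * (Real.sqrt (Fintype.card mm) * (((1 + ((((L ^ r * L ^ kk : ℕ) : ℝ))⁻¹) * ((C / ξ) * Real.exp (((((L ^ r * L ^ kk : ℕ) : ℝ))⁻¹) * (C / ξ)))) ^ (L ^ r) - 1) / ((((L ^ kk : ℕ) : ℝ))⁻¹))))))) ≤ oV →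
        Fintype.card ι * (Fintype.card (Fin (d + 1)) * (oB + Fintype.card ι * ((((L ^ r * L ^ kk : ℕ) : ℝ) * (@basisConst ι _ (Matrix mm mm ℂ) Matrix.frobeniusNormedAddCommGroup Matrix.frobeniusNormedSpace e * (2 * Real.sqrt (Fintype.card mm)) * (Real.sqrt (Fintype.card mm) * ((((d + 1 : ℕ) : ℝ) * ((L ^ r - 1 : ℕ) : ℝ) + (L ^ r : ℕ) + 1) * (((((L ^ r * L ^ kk : ℕ) : ℝ))⁻¹) ^ 2 * ((C / ξ ^ 2) * Real.exp (((((L ^ r * L ^ kk : ℕ) : ℝ))⁻¹) * (C / ξ)))))) + ((1 + Fintype.card ι * (((((L ^ r * L ^ kk : ℕ) : ℝ))⁻¹) * (@basisConst ι _ (Matrix mm mm ℂ) Matrix.frobeniusNormedAddCommGroup Matrix.frobeniusNormedSpace e * (2 * Real.sqrt (Fintype.card mm)) * (Real.sqrt (Fintype.card mm) * (((1 + ((((L ^ r * L ^ kk : ℕ) : ℝ))⁻¹) * ((C / ξ) * Real.exp (((((L ^ r * L ^ kk : ℕ) : ℝ))⁻¹) * (C / ξ)))) ^ (L ^ r) -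 1) / ((((L ^ kk : ℕ) : ℝ))⁻¹)))))) ^ (L ^ r) - 1) * (((((L ^ r * L ^ kk : ℕ) : ℝ))⁻¹) * (@basisConst ι _ (Matrix mm mm ℂ) Matrix.frobeniusNormedAddCommGroup Matrix.frobeniusNormedSpace e * (2 * Real.sqrt (Fintype.card mm)) * (Real.sqrt (Fintype.card mm) * (((1 + ((((L ^ r * L ^ kk : ℕ) : ℝ))⁻¹) * ((C / ξ) * Real.exp (((((L ^ r * L ^ kk : ℕ) : ℝ))⁻¹) * (C / ξ)))) ^ (L ^ r) - 1) / ((((L ^ kk : ℕ) : ℝ))⁻¹))))))) * ((@basisConst ι _ (Matrix mm mm ℂ) Matrix.frobeniusNormedAddCommGroup Matrix.frobeniusNormedSpace e * (2 * Real.sqrt (Fintype.card mm)) * (Real.sqrt (Fintype.card mm) * (((1 + ((((L ^ r * L ^ kk : ℕ) : ℝ))⁻¹) * ((C / ξ) * Real.exp (((((L ^ r * L ^ kk : ℕ) : ℝ))⁻¹) * (C / ξ)))) ^ (L ^ r) - 1) / ((((L ^ kk : ℕ) : ℝ))⁻¹)))) + (((L ^ kk : ℕ) : ℝ) * (@basisConst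 ι _ (Matrix mm mm ℂ) Matrix.frobeniusNormedAddCommGroup Matrix.frobeniusNormedSpace e * (2 * Real.sqrt (Fintype.card mm)) * (Real.sqrt (Fintype.card mm) * ((1 + ((((L ^ r * L ^ kk : ℕ) : ℝ))⁻¹) * (((1 + ((((L ^ r * L ^ kk : ℕ) : ℝ))⁻¹) * ((C / ξ) * Real.exp (((((L ^ r * L ^ kk : ℕ) : ℝ))⁻¹) * (C / ξ)))) ^ (L ^ r) - 1) / ((((L ^ kk : ℕ) : ℝ))⁻¹))) ^ (L ^ r) - 1)))))))) ≤ oV →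
        rV * (1 + Fintype.card (Fin (d + 1) ⊕ Fin (d + 1))) + (a₀ * (Fintype.card ι * (Fintype.card ι * ((1 + rV * ((((L ^ kk : ℕ) : ℝ))⁻¹)) ^ ((d + 1) * L ^ kk) - 1) ^ 2 + 2 * ((1 + rV * ((((L ^ kk : ℕ) : ℝ))⁻¹)) ^ ((d + 1) * L ^ kk) - 1))) + a₀ * (Fintype.card ι * (Fintype.card ι * ((1 + rV * ((((L ^ r * L ^ kk : ℕ) : ℝ))⁻¹)) ^ ((d + 1) * (L ^ r * L ^ kk)) - 1) ^ 2 + 2 * ((1 + rV * ((((L ^ r * L ^ kk : ℕ) : ℝ))⁻¹)) ^ ((d + 1) * (L ^ r * L ^ kk)) - 1)))) ≤ R₀ → oV * (1 + Fintype.card (Fin (d + 1) ⊕ Fin (d + 1))) + (Fintype.card ι * (|aK a₀ (L : ℝ) (r + kk) - aK a₀ (L : ℝ) kk| * (1 + Fintype.card ι) + |aK a₀ (L : ℝ) kk| * (2 * Fintype.card ι * (@basisConst ι _ (Matrix mm mm ℂ) Matrix.frobeniusNormedAddCommGroup Matrix.frobeniusNormedSpace e * (2 * Real.sqrt (Fintype.card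 mm)) * (Real.sqrt (Fintype.card mm) * ((d + 1) * (d * ((((L ^ r * L ^ kk : ℕ) : ℝ)) * (((L ^ r : ℕ) : ℝ) * (((((L ^ r * L ^ kk : ℕ) : ℝ))⁻¹) ^ 2 * ((C / ξ ^ 2) * Real.exp (((((L ^ r * L ^ kk : ℕ) : ℝ))⁻¹) * (C / ξ)))))) + ((1 + (((((L ^ r * L ^ kk : ℕ) : ℝ))⁻¹) * ((C / ξ) * Real.exp (((((L ^ r * L ^ kk : ℕ) : ℝ))⁻¹) * (C / ξ))))) ^ (L ^ r) - 1)))))))) ≤ o →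
      -- (J) the pairing fit of the transporter letters of the direction `μ₀`: any number above the explicit expression of n15-c∕415 at the datum's letters
      ∀ (oa : ℝ), 0 ≤ oa → Fintype.card ι * (((L ^ r * L ^ kk : ℕ) : ℝ) * ((@basisConst ι _ (Matrix mm mm ℂ) Matrix.frobeniusNormedAddCommGroup Matrix.frobeniusNormedSpace e * (2 * Real.sqrt (Fintype.card mm))) * (Real.sqrt (Fintype.card mm) * ((((d + 1 : ℕ) : ℝ) * ((L ^ r - 1 : ℕ) : ℝ) + (L ^ r : ℕ) + 1) * (((((L ^ r * L ^ kk : ℕ) : ℝ))⁻¹) ^ 2 * ((C / ξ ^ 2) * Real.exp (((((L ^ r * L ^ kk : ℕ) : ℝ))⁻¹) * (C / ξ)))))) + ((1 + Fintype.card ι * (((((L ^ r * L ^ kk : ℕ) : ℝ))⁻¹) * (@basisConst ι _ (Matrix mm mm ℂ) Matrix.frobeniusNormedAddCommGroup Matrix.frobeniusNormedSpace e * (2 * Real.sqrt (Fintype.card mm)) * (Real.sqrt (Fintype.card mm) * (((1 + ((((L ^ r * L ^ kk : ℕ) : ℝ))⁻¹) * ((C / ξ) * Real.exp (((((L ^ r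 * L ^ kk : ℕ) : ℝ))⁻¹) * (C / ξ)))) ^ (L ^ r) - 1) / ((((L ^ kk : ℕ) : ℝ))⁻¹)))))) ^ (L ^ r) - 1) * (((((L ^ r * L ^ kk : ℕ) : ℝ))⁻¹) * (@basisConst ι _ (Matrix mm mm ℂ) Matrix.frobeniusNormedAddCommGroup Matrix.frobeniusNormedSpace e * (2 * Real.sqrt (Fintype.card mm)) * (Real.sqrt (Fintype.card mm) * (((1 + ((((L ^ r * L ^ kk : ℕ) : ℝ))⁻¹) * ((C / ξ) * Real.exp (((((L ^ r * L ^ kk : ℕ) : ℝ))⁻¹) * (C / ξ)))) ^ (L ^ r) - 1) / ((((L ^ kk : ℕ) : ℝ))⁻¹))))))) ≤ oa →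
        HasMaj (ScNorm d L mv kk hL ι) (BlockNorm.ofBlocks (unitTorusGeo L kk (cvM d L mv kk hL)) (liftBlk (scBlk d L mv kk hL ∘ kingPr L kk r (cvM d L mv kk hL)) ι))
          (idef (ctauS (cvM d L mv kk hL) L kk r (fun μ x' => coordMat e (ContinuousLinearMap.mulLeftRight ℝ (Matrix mm mm ℂ) ((U' μ x' : Matrix mm mm ℂ)) ((U' μ x' : Matrix mm mm ℂ))ᴴ))) (ctauS (cvM d L mv kk hL) L kk r (fun μ x' => coordMat e (ContinuousLinearMap.mulLeftRight ℝ (Matrix mm mm ℂ) ((U' μ x' : Matrix mm mm ℂ)) ((U' μ x' : Matrix mm mm ℂ))ᴴ))) (covD ((((L ^ r * L ^ kk : ℕ) : ℝ))⁻¹) (fun x' => coordMat e (ContinuousLinearMap.mulLeftRight ℝ (Matrix mm mm ℂ) ((U' μ₀ x' : Matrix mm mm ℂ)) ((U' μ₀ x' : Matrix mm mm ℂ))ᴴ)) (scShift' d L mv kk r hL μ₀) ∘ₗ scGreenOp' d L mv kk r hL (aK a₀ (L : ℝ) (r + kk) * (((L ^ r * L ^ kk : ℕ) : ℝ)) ^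 (d + 1)) ((((L ^ r * L ^ kk : ℕ) : ℝ))⁻¹) ι e (fun μ z => (U' μ z : Matrix mm mm ℂ))) (covD ((((L ^ kk : ℕ) : ℝ))⁻¹) (fun x => coordMat e (ContinuousLinearMap.mulLeftRight ℝ (Matrix mm mm ℂ) ((fun μ y => mprod (fun t => (U' μ (kingSec (cvM d L mv kk hL) L kk r y + t • unitVec (fine (L ^ r * L ^ kk) (cvM d L mv kk hL)) μ) : Matrix mm mm ℂ)) (L ^ r)) μ₀ x) ((fun μ y => mprod (fun t => (U' μ (kingSec (cvM d L mv kk hL) L kk r y + t • unitVec (fine (L ^ r * L ^ kk) (cvM d L mv kk hL)) μ) : Matrix mm mm ℂ)) (L ^ r)) μ₀ x)ᴴ)) (scShift d L mv kk hL μ₀) ∘ₗ scGreenOp d L mv kk hL (aK a₀ (L : ℝ) kk * (((L ^ kk : ℕ) : ℝ)) ^ (d + 1)) ((((L ^ kk : ℕ) : ℝ))⁻¹) ι e (fun μ y => mprod (fun t => (U' μ (kingSec (cvM d L mv kk hL) L kk r y + t • unitVec (fine (L ^ r * L ^ kk) (cvM d L mv kk hL)) μ) : Matrix mm mm ℂ))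 (L ^ r))))
          (fun y y' => D * ((((L : ℝ) ^ kk) ^ (-(1 / 4 : ℝ)) + (o + ((1 + (Fintype.card ι * (((((L ^ r * L ^ kk : ℕ) : ℝ))⁻¹) * (@basisConst ι _ (Matrix mm mm ℂ) Matrix.frobeniusNormedAddCommGroup Matrix.frobeniusNormedSpace e * (2 * Real.sqrt (Fintype.card mm)) * (Real.sqrt (Fintype.card mm) * (((1 + ((((L ^ r * L ^ kk : ℕ) : ℝ))⁻¹) * ((C / ξ) * Real.exp (((((L ^ r * L ^ kk : ℕ) : ℝ))⁻¹) * (C / ξ)))) ^ (L ^ r) - 1) / ((((L ^ kk : ℕ) : ℝ))⁻¹))))))) ^ ((d + 1) * (L ^ r - 1)) - 1))) + oa) * Real.exp (-(δ / 16 * (unitTorusGeo L kk (cvM d L mv kk hL)).dist y y'))) := by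
  obtain ⟨δ, w₀, R₀, D, hδ, hR₀, H⟩ := uN_idef_covD_scGreen_tr (d := d) hL hL7 ha₀ ι μ₀
  obtain ⟨δA, w₀A, R₀A, BA, hδA, hR₀A, hBA, HS⟩ := uN_scGreen_specPair_tr (d := d) hL hL7 ha₀ ι
  have hL3 : 3 ≤ L := (by omega); have hLpos : 0 < L := (by omega)
  refine ⟨δ, max (max w₀ w₀A) 2, min (min R₀ R₀A) 1, D, hδ, lt_min (lt_min hR₀ hR₀A) one_pos, fun mv kk r hk hr hw₀ => ?_⟩
  intro mm _ _ _ e he U' hU'g Q ξ C β Cβ hξ hC hβ hCβ h335 hQ rV oV o oB hrV hoV hoB hBle hrA hrC hoA hoC hRle hole oa hoa0 hoD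
  have hw₀' : w₀ ≤ ((L ^ mv : ℕ) : ℝ) := ((le_max_left _ _).trans (le_max_left _ _)).trans hw₀
  have hw₀A : w₀A ≤ ((L ^ mv : ℕ) : ℝ) := ((le_max_right _ _).trans (le_max_left _ _)).trans hw₀
  have hW2 : 2 ≤ L ^ mv := by have h := (le_max_right (max w₀ w₀A) 2).trans hw₀; exact_mod_cast h
  have hη : (0 : ℝ) < ((((L ^ kk : ℕ) : ℝ))⁻¹) := inv_pos.mpr (Nat.cast_pos.mpr (pow_pos hLpos kk))
  have hη' : (0 : ℝ) < ((((L ^ r * L ^ kk : ℕ) : ℝ))⁻¹) := inv_pos.mpr (Nat.cast_pos.mpr (Nat.mul_pos (pow_pos hLpos r) (pow_pos hLpos kk)))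
  have hM : ∀ ν, cvM d L mv kk hL ν = 2 * L * L ^ mv := MP_succ_eq L mv kk hL
  have hm₁ : 2 * L ^ mv ≤ coverMargin L mv := two_mul_le_coverMargin hL7 mv
  have hfitI : coverMargin L mv - 2 * L ^ mv + (6 * L ^ mv + 1) ≤ L * L ^ mv := coverMargin_inner_fit hL7 hW2
  have hS0 : L * L ^ mv ≤ 2 * L * L ^ mv := (by rw [mul_assoc]; omega)
  have hLr : 0 < L ^ r := pow_pos hLpos r
  -- (g36) `r_V ≤ 1` DERIVED: the threshold's left side dominates `r_V` (the `a₀`-terms are `≥ 0`), its right side is `≤ 1`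
  have hI0 : (0 : ℝ) ≤ (Fintype.card ι : ℝ) := Nat.cast_nonneg _
  have hJJ0 : (0 : ℝ) ≤ (Fintype.card (Fin (d + 1) ⊕ Fin (d + 1)) : ℝ) := Nat.cast_nonneg _
  have hE10 : (0 : ℝ) ≤ (1 + rV * ((((L ^ kk : ℕ) : ℝ))⁻¹)) ^ ((d + 1) * L ^ kk) - 1 := by
    have := one_le_pow₀ (M₀ := ℝ) (a := 1 + rV * ((((L ^ kk : ℕ) : ℝ))⁻¹)) (le_add_of_nonneg_right (mul_nonneg hrV hη.le)) (n := (d + 1) * L ^ kk); linarith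
  have hE20 : (0 : ℝ) ≤ (1 + rV * ((((L ^ r * L ^ kk : ℕ) : ℝ))⁻¹)) ^ ((d + 1) * (L ^ r * L ^ kk)) - 1 := by
    have := one_le_pow₀ (M₀ := ℝ) (a := 1 + rV * ((((L ^ r * L ^ kk : ℕ) : ℝ))⁻¹)) (le_add_of_nonneg_right (mul_nonneg hrV hη'.le)) (n := (d + 1) * (L ^ r * L ^ kk)); linarith
  have hrV1 : rV ≤ 1 := by
    have h1 := mul_nonneg ha₀.le (mul_nonneg hI0 (add_nonneg (mul_nonneg hI0 (sq_nonneg ((1 + rV * ((((L ^ kk : ℕ) : ℝ))⁻¹)) ^ ((d + 1) * L ^ kk) - 1))) (mul_nonneg zero_le_two hE10)))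
    have h2 := mul_nonneg ha₀.le (mul_nonneg hI0 (add_nonneg (mul_nonneg hI0 (sq_nonneg ((1 + rV * ((((L ^ r * L ^ kk : ℕ) : ℝ))⁻¹)) ^ ((d + 1) * (L ^ r * L ^ kk)) - 1))) (mul_nonneg zero_le_two hE20)))
    have h3 : rV ≤ rV * (1 + (Fintype.card (Fin (d + 1) ⊕ Fin (d + 1)) : ℝ)) := le_mul_of_one_le_right hrV (le_add_of_nonneg_right hJJ0)
    have h4 : min (min R₀ R₀A) 1 ≤ 1 := min_le_right _ _
    linarith [hRle]
  -- the cube gauges from the datum (n15-c∕370): pointwise, step and PAIRWISE four-point letters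
  have hex := fun k => uN_exists_gauge_pairLetters_of_reg335HolderCube (scShift' d L mv kk r hL) U' hη' hξ hβ hCβ (h335 k)
  choose u' hu' hw1 hw2 hw3 using hex
  -- unitarity of the plain fields
  have hU' : ∀ μ (z : ScX' d L mv kk r hL), ((U' μ z : Matrix mm mm ℂ))ᴴ * (U' μ z : Matrix mm mm ℂ) = 1 := fun μ z => Matrix.mem_unitaryGroup_iff'.mp (hU'g μ z)
  have hU : ∀ μ (x : ScX d L mv kk hL), (mprod (fun t => (U' μ (kingSec (cvM d L mv kk hL) L kk r x + t • unitVec (fine (L ^ r * L ^ kk) (cvM d L mv kk hL)) μ) : Matrix mm mm ℂ)) (L ^ r))ᴴ * mprod (fun t => (U' μ (kingSec (cvM d L mv kk hL) L kk r x + t • unitVec (fine (L ^ r * L ^ kk) (cvM d L mv kk hL)) μ) : Matrix mm mm ℂ)) (L ^ r) = 1 :=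
    fun μ x => conjTranspose_mprod_mul_self (fun t _ => hU' μ _)
  -- the letters
  have hpf0 : (0 : ℝ) ≤ ((C / ξ) * Real.exp (((((L ^ r * L ^ kk : ℕ) : ℝ))⁻¹) * (C / ξ))) := by positivity
  have hqf0 : (0 : ℝ) ≤ ((C / ξ ^ 2) * Real.exp (((((L ^ r * L ^ kk : ℕ) : ℝ))⁻¹) * (C / ξ))) := by positivity
  have hb0 : (0 : ℝ) ≤ (((((L ^ r * L ^ kk : ℕ) : ℝ))⁻¹) ^ 2 * ((C / ξ ^ 2) * Real.exp (((((L ^ r * L ^ kk : ℕ) : ℝ))⁻¹) * (C / ξ)))) := by positivity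
  have hΩ0 : (0 : ℝ) ≤ ((((d + 1 : ℕ) : ℝ) * ((L ^ r - 1 : ℕ) : ℝ) + (L ^ r : ℕ) + 1) * (((((L ^ r * L ^ kk : ℕ) : ℝ))⁻¹) ^ 2 * ((C / ξ ^ 2) * Real.exp (((((L ^ r * L ^ kk : ℕ) : ℝ))⁻¹) * (C / ξ))))) := by positivity
  have hpf_le : ((C / ξ) * Real.exp (((((L ^ r * L ^ kk : ℕ) : ℝ))⁻¹) * (C / ξ))) ≤ (((1 + ((((L ^ r * L ^ kk : ℕ) : ℝ))⁻¹) * ((C / ξ) * Real.exp (((((L ^ r * L ^ kk : ℕ) : ℝ))⁻¹) * (C / ξ)))) ^ (L ^ r) - 1) / ((((L ^ kk : ℕ) : ℝ))⁻¹)) := by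
    have hB1 : 1 + ((L ^ r : ℕ) : ℝ) * (((((L ^ r * L ^ kk : ℕ) : ℝ))⁻¹) * ((C / ξ) * Real.exp (((((L ^ r * L ^ kk : ℕ) : ℝ))⁻¹) * (C / ξ)))) ≤ (1 + ((((L ^ r * L ^ kk : ℕ) : ℝ))⁻¹) * ((C / ξ) * Real.exp (((((L ^ r * L ^ kk : ℕ) : ℝ))⁻¹) * (C / ξ)))) ^ (L ^ r) := one_add_mul_le_pow (by nlinarith [mul_nonneg hη'.le hpf0]) _
    have hsc : ((L ^ r : ℕ) : ℝ) * ((((L ^ r * L ^ kk : ℕ) : ℝ))⁻¹) = ((((L ^ kk : ℕ) : ℝ))⁻¹) := by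
      rw [Nat.cast_mul, mul_inv, ← mul_assoc, mul_inv_cancel₀ (by positivity), one_mul]
    rw [le_div_iff₀ hη]
    calc ((C / ξ) * Real.exp (((((L ^ r * L ^ kk : ℕ) : ℝ))⁻¹) * (C / ξ))) * ((((L ^ kk : ℕ) : ℝ))⁻¹) = ((L ^ r : ℕ) : ℝ) * (((((L ^ r * L ^ kk : ℕ) : ℝ))⁻¹) * ((C / ξ) * Real.exp (((((L ^ r * L ^ kk : ℕ) : ℝ))⁻¹) * (C / ξ)))) := by rw [← hsc]; ring
      _ ≤ (1 + ((((L ^ r * L ^ kk : ℕ) : ℝ))⁻¹) * ((C / ξ) * Real.exp (((((L ^ r * L ^ kk : ℕ) : ℝ))⁻¹) * (C / ξ)))) ^ (L ^ r) - 1 := by linarith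
  have hqf_le : ((C / ξ ^ 2) * Real.exp (((((L ^ r * L ^ kk : ℕ) : ℝ))⁻¹) * (C / ξ))) ≤ (((C / ξ ^ 2) * Real.exp (((((L ^ r * L ^ kk : ℕ) : ℝ))⁻¹) * (C / ξ))) * (1 + ((((L ^ r * L ^ kk : ℕ) : ℝ))⁻¹) * ((C / ξ) * Real.exp (((((L ^ r * L ^ kk : ℕ) : ℝ))⁻¹) * (C / ξ)))) ^ (L ^ r)) := le_mul_of_one_le_right hqf0 (one_le_pow₀ (by nlinarith [mul_nonneg hη'.le hpf0]))
  have hp : (0 : ℝ) ≤ (((1 + ((((L ^ r * L ^ kk : ℕ) : ℝ))⁻¹) * ((C / ξ) * Real.exp (((((L ^ r * L ^ kk : ℕ) : ℝ))⁻¹) * (C / ξ)))) ^ (L ^ r) - 1) / ((((L ^ kk : ℕ) : ℝ))⁻¹)) := hpf0.trans hpf_le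
  have hq : (0 : ℝ) ≤ (((C / ξ ^ 2) * Real.exp (((((L ^ r * L ^ kk : ℕ) : ℝ))⁻¹) * (C / ξ))) * (1 + ((((L ^ r * L ^ kk : ℕ) : ℝ))⁻¹) * ((C / ξ) * Real.exp (((((L ^ r * L ^ kk : ℕ) : ℝ))⁻¹) * (C / ξ)))) ^ (L ^ r)) := hqf0.trans hqf_le
  -- memberships (n15-c∕347)
  have hcol : ∀ k (z : ScX' d L mv kk r hL), (∃ y ∈ cvSk d L mv kk hL k, (unitTorusGeo L kk (cvM d L mv kk hL)).dist (scBlk' d L mv kk r hL z) y ≤ 3) → z ∈ Q k ∧ ∀ κ, scShift' d L mv kk r hL κ z ∈ Q k ∧ (scShift' d L mv kk r hL κ).symm z ∈ Q k ∧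
      ∀ μ, scShift' d L mv kk r hL μ (scShift' d L mv kk r hL κ z) ∈ Q k ∧ scShift' d L mv kk r hL μ ((scShift' d L mv kk r hL κ).symm z) ∈ Q k := fun k z hz => sc_collar_mem (hQ k) z hz
  -- fine letters on `Qf k = {dist(B′(z), 𝔅_k) ≤ 3}`
  have hF1f : ∀ k μ (z : ScX' d L mv kk r hL), (∃ y ∈ cvSk d L mv kk hL k, (unitTorusGeo L kk (cvM d L mv kk hL)).dist (scBlk' d L mv kk r hL z) y ≤ 3) → ‖u' k z * (U' μ z : Matrix mm mm ℂ) * (u' k (scShift' d L mv kk r hL μ z))ᴴ - 1‖ ≤ ((((L ^ r * L ^ kk : ℕ) : ℝ))⁻¹) * ((C / ξ) * Real.exp (((((L ^ r * L ^ kk : ℕ) : ℝ))⁻¹) * (C / ξ))) := fun k μ z hz => by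
    obtain ⟨hz0, hzs⟩ := hcol k z hz
    exact hw1 k μ z hz0 (hzs μ).1
  have hF2f : ∀ k μ (z : ScX' d L mv kk r hL), (∃ y ∈ cvSk d L mv kk hL k, (unitTorusGeo L kk (cvM d L mv kk hL)).dist (scBlk' d L mv kk r hL z) y ≤ 3) →
      ‖u' k z * (U' μ z : Matrix mm mm ℂ) * (u' k (scShift' d L mv kk r hL μ z))ᴴ - (u' k ((scShift' d L mv kk r hL μ).symm z) * (U' μ ((scShift' d L mv kk r hL μ).symm z) : Matrix mm mm ℂ) * (u' k (scShift' d L mv kk r hL μ ((scShift' d L mv kk r hL μ).symm z)))ᴴ)‖ ≤ ((((L ^ r * L ^ kk : ℕ) : ℝ))⁻¹) ^ 2 * ((C / ξ ^ 2) * Real.exp (((((L ^ r * L ^ kk : ℕ) : ℝ))⁻¹) * (C / ξ))) := fun k μ z hz => by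
    obtain ⟨hz0, hzs⟩ := hcol k z hz
    have e0 : scShift' d L mv kk r hL μ ((scShift' d L mv kk r hL μ).symm z) = z := Equiv.apply_symm_apply _ _
    set fA : ScX' d L mv kk r hL → Matrix mm mm ℂ := fun w => u' k w * (U' μ w : Matrix mm mm ℂ) * (u' k (scShift' d L mv kk r hL μ w))ᴴ with hfA
    have h : ‖fA (scShift' d L mv kk r hL μ ((scShift' d L mv kk r hL μ).symm z)) - fA ((scShift' d L mv kk r hL μ).symm z)‖ ≤ ((((L ^ r * L ^ kk : ℕ) : ℝ))⁻¹) ^ 2 * ((C / ξ ^ 2) * Real.exp (((((L ^ r * L ^ kk : ℕ) : ℝ))⁻¹) * (C / ξ))) :=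
      hw2 k μ μ ((scShift' d L mv kk r hL μ).symm z) (hzs μ).2.1 (by rw [e0]; exact hz0) (by rw [e0]; exact hz0) (by rw [e0]; exact (hzs μ).1)
    rw [e0] at h
    exact h
  have hstep : ∀ k κ μ (z : ScX' d L mv kk r hL), (∃ y ∈ cvSk d L mv kk hL k, (unitTorusGeo L kk (cvM d L mv kk hL)).dist (scBlk' d L mv kk r hL z) y ≤ 3) →
      ‖u' k (z + unitVec (fine (L ^ r * L ^ kk) (cvM d L mv kk hL)) κ) * (U' μ (z + unitVec (fine (L ^ r * L ^ kk) (cvM d L mv kk hL)) κ) : Matrix mm mm ℂ) * (u' k ((z + unitVec (fine (L ^ r * L ^ kk) (cvM d L mv kk hL)) κ) + unitVec (fine (L ^ r * L ^ kk) (cvM d L mv kk hL)) μ))ᴴ - (u' k z * (U' μ z : Matrix mm mm ℂ) * (u' k (z + unitVec (fine (L ^ r * L ^ kk) (cvM d L mv kk hL)) μ))ᴴ)‖ ≤ (((((L ^ r * L ^ kk : ℕ) : ℝ))⁻¹) ^ 2 * ((C / ξ ^ 2) * Real.exp (((((L ^ r * L ^ kk : ℕ) : ℝ))⁻¹) * (C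 / ξ)))) := fun k κ μ z hz => by
    obtain ⟨hz0, hzs⟩ := hcol k z hz
    exact hw2 k κ μ z hz0 (hzs κ).1 (hzs μ).1 ((hzs κ).2.2 μ).1
  -- block-distance witnesses
  have hblk : ∀ z : ScX' d L mv kk r hL, scBlk' d L mv kk r hL z = scBlk d L mv kk hL (kingPr L kk r (cvM d L mv kk hL) z) := fun z => (CovAvg.blockOf_kingPr (L := L) (k := kk) (m := r) (M := cvM d L mv kk hL) z).symm
  have hd0 : ∀ k (x' : ScX' d L mv kk r hL), scChi d L mv kk hL k (kingPr L kk r (cvM d L mv kk hL) x') ≠ 0 → ∃ y ∈ cvSk d L mv kk hL k, (unitTorusGeo L kk (cvM d L mv kk hL)).dist (scBlk' d L mv kk r hL x') y ≤ 0 := fun k x' hχ =>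
    ⟨_, scBlk_mem_cvSk_of_scChi_ne_zero hM hm₁ hfitI hS0 hχ, by rw [hblk x']; exact le_of_eq (tdistT_self _ _)⟩
  have hmono : ∀ k (z : ScX' d L mv kk r hL) (a : ℝ), a ≤ 3 → (∃ y ∈ cvSk d L mv kk hL k, (unitTorusGeo L kk (cvM d L mv kk hL)).dist (scBlk' d L mv kk r hL z) y ≤ a) → ∃ y ∈ cvSk d L mv kk hL k, (unitTorusGeo L kk (cvM d L mv kk hL)).dist (scBlk' d L mv kk r hL z) y ≤ 3 :=
    fun k z a ha ⟨y, hy, hd⟩ => ⟨y, hy, hd.trans ha⟩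
  have hline : ∀ k μ (x : ScX d L mv kk hL), (∃ y ∈ cvSk d L mv kk hL k, (unitTorusGeo L kk (cvM d L mv kk hL)).dist (scBlk d L mv kk hL x) y ≤ 1) → ∀ t < L ^ r, ∀ s ≤ L ^ r,
      ∃ y ∈ cvSk d L mv kk hL k, (unitTorusGeo L kk (cvM d L mv kk hL)).dist (scBlk' d L mv kk r hL (kingSec (cvM d L mv kk hL) L kk r x + t • unitVec (fine (L ^ r * L ^ kk) (cvM d L mv kk hL)) μ - s • unitVec (fine (L ^ r * L ^ kk) (cvM d L mv kk hL)) μ)) y ≤ 3 := fun k μ x ⟨y, hy, hd⟩ t ht s hs =>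
    hmono k _ (1 + 1) (by norm_num) (exists_tdist_le_succ (tdist_scBlk'_line_le μ x ht hs) ⟨y, hy, hd⟩)
  have hcut : ∀ k (x : ScX d L mv kk hL), scChi d L mv kk hL k x ≠ 0 → (∃ y ∈ cvSk d L mv kk hL k, (unitTorusGeo L kk (cvM d L mv kk hL)).dist (scBlk d L mv kk hL x) y ≤ 1) ∧ ∀ μ, ∃ y ∈ cvSk d L mv kk hL k, (unitTorusGeo L kk (cvM d L mv kk hL)).dist (scBlk d L mv kk hL ((scShift d L mv kk hL μ).symm x)) y ≤ 1 :=
    fun k x hχ => ⟨⟨_, scBlk_mem_cvSk_of_scChi_ne_zero hM hm₁ hfitI hS0 hχ, (le_of_eq (tdistT_self _ _)).trans zero_le_one⟩,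
      fun μ => ⟨_, scBlk_mem_cvSk_of_scChi_ne_zero hM hm₁ hfitI hS0 hχ, tdist_scBlk_scShift_symm_le μ x⟩⟩
  -- coarse letters along the fine lines (n15-c∕341)
  have hC : ∀ k μ (x : ScX d L mv kk hL), (∃ y ∈ cvSk d L mv kk hL k, (unitTorusGeo L kk (cvM d L mv kk hL)).dist (scBlk d L mv kk hL x) y ≤ 1) →
      ‖u' k (kingSec (cvM d L mv kk hL) L kk r x) * mprod (fun t => (U' μ (kingSec (cvM d L mv kk hL) L kk r x + t • unitVec (fine (L ^ r * L ^ kk) (cvM d L mv kk hL)) μ) : Matrix mm mm ℂ)) (L ^ r) * (u' k (kingSec (cvM d L mv kk hL) L kk r (scShift d L mv kk hL μ x)))ᴴ - 1‖ ≤ ((((L ^ kk : ℕ) : ℝ))⁻¹) * (((1 + ((((L ^ r * L ^ kk : ℕ) : ℝ))⁻¹) * ((C / ξ) * Real.exp (((((L ^ r * L ^ kk : ℕ) : ℝ))⁻¹) * (C / ξ)))) ^ (L ^ r) - 1) / ((((L ^ kk : ℕ) : ℝ))⁻¹)) ∧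
      ‖u' k (kingSec (cvM d L mv kk hL) L kk r x) * mprod (fun t => (U' μ (kingSec (cvM d L mv kk hL) L kk r x + t • unitVec (fine (L ^ r * L ^ kk) (cvM d L mv kk hL)) μ) : Matrix mm mm ℂ)) (L ^ r) * (u' k (kingSec (cvM d L mv kk hL) L kk r (scShift d L mv kk hL μ x)))ᴴ -
          u' k (kingSec (cvM d L mv kk hL) L kk r ((scShift d L mv kk hL μ).symm x)) * mprod (fun t => (U' μ (kingSec (cvM d L mv kk hL) L kk r ((scShift d L mv kk hL μ).symm x) + t • unitVec (fine (L ^ r * L ^ kk) (cvM d L mv kk hL)) μ) : Matrix mm mm ℂ)) (L ^ r) *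
            (u' k (kingSec (cvM d L mv kk hL) L kk r (scShift d L mv kk hL μ ((scShift d L mv kk hL μ).symm x))))ᴴ‖ ≤ ((((L ^ kk : ℕ) : ℝ))⁻¹) ^ 2 * (((C / ξ ^ 2) * Real.exp (((((L ^ r * L ^ kk : ℕ) : ℝ))⁻¹) * (C / ξ))) * (1 + ((((L ^ r * L ^ kk : ℕ) : ℝ))⁻¹) * ((C / ξ) * Real.exp (((((L ^ r * L ^ kk : ℕ) : ℝ))⁻¹) * (C / ξ)))) ^ (L ^ r)) := fun k μ x hx =>
    norm_scGauged_pairing_letters (hu' := hu' k) (fun μ z => (U' μ z : Matrix mm mm ℂ)) (U := (fun μ y => mprod (fun t => (U' μ (kingSec (cvM d L mv kk hL) L kk r y + t • unitVec (fine (L ^ r * L ^ kk) (cvM d L mv kk hL)) μ) : Matrix mm mm ℂ)) (L ^ r))) μ (fun y => rfl) (Qf := (fun k => {z : ScX' d L mv kk r hL | ∃ y ∈ cvSk d L mv kk hL k, (unitTorusGeo L kk (cvM d L mv kk hL)).dist (scBlk' d L mv kk r hL z) y ≤ 3}) k) hpf0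
      (fun z hz => hF1f k μ z hz) (fun z hz => hF2f k μ z hz) x (fun t ht s hs => hline k μ x hx t ht s hs)
  -- the oscillation row (n15-c∕347) and the two fits (n15-c∕343, n15-c∕344)
  have hΩ := sc_hΩ_of_stepLetters hM hm₁ hfitI hS0 u' (fun μ z => (U' μ z : Matrix mm mm ℂ)) hb0 hstep
  have hQlA : ∀ k (x' : ScX' d L mv kk r hL), scChi d L mv kk hL k (kingPr L kk r (cvM d L mv kk hL) x') ≠ 0 → ∀ μ t, t < L ^ r → kingSec (cvM d L mv kk hL) L kk r (kingPr L kk r (cvM d L mv kk hL) x') + t • unitVec (fine (L ^ r * L ^ kk) (cvM d L mv kk hL)) μ ∈ (fun k => {z : ScX' d L mv kk r hL | ∃ y ∈ cvSk d L mv kk hL k, (unitTorusGeo L kk (cvM d L mv kk hL)).dist (scBlk' d L mv kk r hL z) y ≤ 3}) k ∧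
      kingSec (cvM d L mv kk hL) L kk r ((scShift d L mv kk hL μ).symm (kingPr L kk r (cvM d L mv kk hL) x')) + t • unitVec (fine (L ^ r * L ^ kk) (cvM d L mv kk hL)) μ ∈ (fun k => {z : ScX' d L mv kk r hL | ∃ y ∈ cvSk d L mv kk hL k, (unitTorusGeo L kk (cvM d L mv kk hL)).dist (scBlk' d L mv kk r hL z) y ≤ 3}) k := fun k x' hχ μ t ht => by
    obtain ⟨h0, h1⟩ := hcut k _ hχ
    have ha := hline k μ _ h0 t ht 0 (Nat.zero_le _)
    have hb := hline k μ _ (h1 μ) t ht 0 (Nat.zero_le _)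
    rw [zero_smul, sub_zero] at ha hb
    exact ⟨ha, hb⟩
  have hQlC : ∀ k (x' : ScX' d L mv kk r hL), scChi d L mv kk hL k (kingPr L kk r (cvM d L mv kk hL) x') ≠ 0 → ∀ μ, (scShift' d L mv kk r hL μ).symm x' ∈ (fun k => {z : ScX' d L mv kk r hL | ∃ y ∈ cvSk d L mv kk hL k, (unitTorusGeo L kk (cvM d L mv kk hL)).dist (scBlk' d L mv kk r hL z) y ≤ 3}) k ∧ ∀ t, t < L ^ r → kingSec (cvM d L mv kk hL) L kk r (kingPr L kk r (cvM d L mv kk hL) x') + t • unitVec (fine (L ^ r * L ^ kk) (cvM d L mv kk hL)) μ ∈ (fun k => {z : ScX' d L mv kk r hL | ∃ y ∈ cvSk d L mv kk hL k, (unitTorusGeo L kk (cvM d L mv kk hL)).dist (scBlk' d L mv kk r hL z) y ≤ 3}) k ∧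
      kingSec (cvM d L mv kk hL) L kk r ((scShift d L mv kk hL μ).symm (kingPr L kk r (cvM d L mv kk hL) x')) + t • unitVec (fine (L ^ r * L ^ kk) (cvM d L mv kk hL)) μ ∈ (fun k => {z : ScX' d L mv kk r hL | ∃ y ∈ cvSk d L mv kk hL k, (unitTorusGeo L kk (cvM d L mv kk hL)).dist (scBlk' d L mv kk r hL z) y ≤ 3}) k := fun k x' hχ μ =>
    ⟨hmono k _ (0 + 1) (by norm_num) (exists_tdist_le_succ (tdist_scBlk'_scShift'_symm_le μ x') (hd0 k x' hχ)), fun t ht => hQlA k x' hχ μ t ht⟩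
  have hfitA := sc_hfitA_of_pairing e u' hu' (fun μ z => (U' μ z : Matrix mm mm ℂ)) hU' (fun μ y => mprod (fun t => (U' μ (kingSec (cvM d L mv kk hL) L kk r y + t • unitVec (fine (L ^ r * L ^ kk) (cvM d L mv kk hL)) μ) : Matrix mm mm ℂ)) (L ^ r)) (fun μ y => rfl) (fun k => {z : ScX' d L mv kk r hL | ∃ y ∈ cvSk d L mv kk hL k, (unitTorusGeo L kk (cvM d L mv kk hL)).dist (scBlk' d L mv kk r hL z) y ≤ 3}) hp hΩ0 (fun k μ z hz => (hF1f k μ z hz).trans (mul_le_mul_of_nonneg_left hpf_le hη'.le)) hQlA hΩ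
  -- memberships: up to two steps from a site within three blocks of the plateau stay within five blocks, then `hQ`
  have hmono' : ∀ k (z : ScX' d L mv kk r hL) (a b : ℝ), a ≤ b → (∃ y ∈ cvSk d L mv kk hL k, (unitTorusGeo L kk (cvM d L mv kk hL)).dist (scBlk' d L mv kk r hL z) y ≤ a) → ∃ y ∈ cvSk d L mv kk hL k, (unitTorusGeo L kk (cvM d L mv kk hL)).dist (scBlk' d L mv kk r hL z) y ≤ b :=
    fun k z a b hab ⟨y, hy, hd⟩ => ⟨y, hy, hd.trans hab⟩
  have hup : ∀ k (w : ScX' d L mv kk r hL) (a : ℝ), (∃ y ∈ cvSk d L mv kk hL k, (unitTorusGeo L kk (cvM d L mv kk hL)).dist (scBlk' d L mv kk r hL w) y ≤ a) → ∀ κ, ∃ y ∈ cvSk d L mv kk hL k, (unitTorusGeo L kk (cvM d L mv kk hL)).dist (scBlk' d L mv kk r hL (scShift' d L mv kk r hL κ w)) y ≤ a + 1 :=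
    fun k w a hw κ => exists_tdist_le_succ (tdistT_scBlk'_scShift'_le κ w) hw
  have hQ' : ∀ k (w : ScX' d L mv kk r hL) (a : ℝ), a ≤ 5 → (∃ y ∈ cvSk d L mv kk hL k, (unitTorusGeo L kk (cvM d L mv kk hL)).dist (scBlk' d L mv kk r hL w) y ≤ a) → w ∈ Q k :=
    fun k w a ha hw => hQ k w (hmono' k w a 5 ha hw)
  -- the PAIRWISE four-point letter at the sites within three blocks of the plateau at fine distance `≤ 2L^r` (threshold `ρ = 2L^r·η′ = 2η ≤ 1`)
  have hρ0 : (0 : ℝ) ≤ (2 * ((L ^ r : ℕ) : ℝ) * ((((L ^ r * L ^ kk : ℕ) : ℝ))⁻¹)) := by positivity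
  have hρ1 : (2 * ((L ^ r : ℕ) : ℝ) * ((((L ^ r * L ^ kk : ℕ) : ℝ))⁻¹)) ≤ 1 := by
    have hk2 : (2 : ℝ) ≤ ((L ^ kk : ℕ) : ℝ) := by
      have h7 : 7 ≤ L ^ kk := le_trans hL7 (Nat.le_self_pow (by omega) L)
      exact_mod_cast (le_trans (by norm_num) h7)
    have hLr' : (0 : ℝ) < ((L ^ r : ℕ) : ℝ) := by exact_mod_cast hLr
    rw [Nat.cast_mul, mul_inv, show 2 * ((L ^ r : ℕ) : ℝ) * ((((L ^ r : ℕ) : ℝ))⁻¹ * (((L ^ kk : ℕ) : ℝ))⁻¹) = 2 * (((L ^ r : ℕ) : ℝ) * (((L ^ r : ℕ) : ℝ))⁻¹) * (((L ^ kk : ℕ) : ℝ))⁻¹ by ring, mul_inv_cancel₀ hLr'.ne', mul_one]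
    rw [mul_inv_le_iff₀ (by positivity), one_mul]
    exact hk2
  have hGf0 : (0 : ℝ) ≤ ((Cβ * (ξ ^ (2 + β))⁻¹ * (2 * ((L ^ r : ℕ) : ℝ) * ((((L ^ r * L ^ kk : ℕ) : ℝ))⁻¹)) ^ β + 2 * ((((L ^ r * L ^ kk : ℕ) : ℝ))⁻¹) * ((C / ξ) * (C / ξ ^ 2))) * Real.exp (5 * (((((L ^ r * L ^ kk : ℕ) : ℝ))⁻¹) * (C / ξ)))) := by
    have : (0 : ℝ) ≤ (2 * ((L ^ r : ℕ) : ℝ) * ((((L ^ r * L ^ kk : ℕ) : ℝ))⁻¹)) ^ β := Real.rpow_nonneg hρ0 β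
    have : (0 : ℝ) < ξ ^ (2 + β) := Real.rpow_pos_of_pos hξ _
    positivity
  have hHf : ∀ k μ (z z' : ScX' d L mv kk r hL), (∃ y ∈ cvSk d L mv kk hL k, (unitTorusGeo L kk (cvM d L mv kk hL)).dist (scBlk' d L mv kk r hL z) y ≤ 3) → (∃ y ∈ cvSk d L mv kk hL k, (unitTorusGeo L kk (cvM d L mv kk hL)).dist (scBlk' d L mv kk r hL z') y ≤ 3) →
      tdistT (fine (L ^ r * L ^ kk) (cvM d L mv kk hL)) z z' ≤ 2 * ((L ^ r : ℕ) : ℝ) →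
      ‖(u' k (z + unitVec (fine (L ^ r * L ^ kk) (cvM d L mv kk hL)) μ) * (U' μ (z + unitVec (fine (L ^ r * L ^ kk) (cvM d L mv kk hL)) μ) : Matrix mm mm ℂ) * (u' k (z + unitVec (fine (L ^ r * L ^ kk) (cvM d L mv kk hL)) μ + unitVec (fine (L ^ r * L ^ kk) (cvM d L mv kk hL)) μ))ᴴ - u' k z * (U' μ z : Matrix mm mm ℂ) * (u' k (z + unitVec (fine (L ^ r * L ^ kk) (cvM d L mv kk hL)) μ))ᴴ) -
        (u' k (z' + unitVec (fine (L ^ r * L ^ kk) (cvM d L mv kk hL)) μ) * (U' μ (z' + unitVec (fine (L ^ r * L ^ kk) (cvM d L mv kk hL)) μ) : Matrix mm mm ℂ) * (u' k (z' + unitVec (fine (L ^ r * L ^ kk) (cvM d L mv kk hL)) μ + unitVec (fine (L ^ r * L ^ kk) (cvM d L mv kk hL)) μ))ᴴ - u' k z' * (U' μ z' : Matrix mm mm ℂ) * (u' k (z' + unitVec (fine (L ^ r * L ^ kk) (cvM d L mv kk hL)) μ))ᴴ)‖ ≤ ((((L ^ r * L ^ kk : ℕ) : ℝ))⁻¹)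 ^ 2 * ((Cβ * (ξ ^ (2 + β))⁻¹ * (2 * ((L ^ r : ℕ) : ℝ) * ((((L ^ r * L ^ kk : ℕ) : ℝ))⁻¹)) ^ β + 2 * ((((L ^ r * L ^ kk : ℕ) : ℝ))⁻¹) * ((C / ξ) * (C / ξ ^ 2))) * Real.exp (5 * (((((L ^ r * L ^ kk : ℕ) : ℝ))⁻¹) * (C / ξ)))) := by
    intro k μ z z' hz hz' hd
    have m0 := hQ' k z 3 (by norm_num) hz
    have p1 := hup k z 3 hz
    have mμ := hQ' k _ _ (by norm_num) (p1 μ)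
    have p2 := hup k _ _ (p1 μ)
    have mμμ := hQ' k _ _ (by norm_num) (p2 μ)
    have m0' := hQ' k z' 3 (by norm_num) hz'
    have p1' := hup k z' 3 hz'
    have mμ' := hQ' k _ _ (by norm_num) (p1' μ)
    have p2' := hup k _ _ (p1' μ)
    have mμμ' := hQ' k _ _ (by norm_num) (p2' μ)
    have hdz : ((((L ^ r * L ^ kk : ℕ) : ℝ))⁻¹) * tdistT (fine (L ^ r * L ^ kk) (cvM d L mv kk hL)) z z' ≤ (2 * ((L ^ r : ℕ) : ℝ) * ((((L ^ r * L ^ kk : ℕ) : ℝ))⁻¹)) :=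
      (mul_le_mul_of_nonneg_left hd hη'.le).trans_eq (by ring)
    have hpos : z ≠ z' → 0 < ((((L ^ r * L ^ kk : ℕ) : ℝ))⁻¹) * tdistT (fine (L ^ r * L ^ kk) (cvM d L mv kk hL)) z z' :=
      fun hne => mul_pos hη' (lt_of_lt_of_le one_pos (one_le_tdistT_of_ne _ hne))
    exact hw3 k μ μ z z' m0 mμ m0' mμ' mμ mμμ mμ' mμμ' (2 * ((L ^ r : ℕ) : ℝ) * ((((L ^ r * L ^ kk : ℕ) : ℝ))⁻¹)) hρ0 hdz hρ1 hpos
  -- n15-c∕344's displayed input `hB` PRODUCED (n15-c∕369) at the explicit `o_B`, then weakened to the given `oB`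
  have hB : ∀ k μ x', scChi d L mv kk hL k (kingPr L kk r (cvM d L mv kk hL) x') ≠ 0 → ∀ i j, |(((((((L ^ r * L ^ kk : ℕ) : ℝ))⁻¹))⁻¹ * (((((L ^ r * L ^ kk : ℕ) : ℝ))⁻¹))⁻¹) • (coordMat e (ContinuousLinearMap.mulLeftRight ℝ (Matrix mm mm ℂ) (u' k x' * (U' μ x' : Matrix mm mm ℂ) * (u' k (scShift' d L mv kk r hL μ x'))ᴴ) (u' k x' * (U' μ x' : Matrix mm mm ℂ) * (u' k (scShift' d L mv kk r hL μ x'))ᴴ)ᴴ) - coordMat e (ContinuousLinearMap.mulLeftRight ℝ (Matrix mm mm ℂ) (u' k ((scShift' d L mv kk r hL μ).symm x') * (U' μ ((scShift' d L mv kk r hL μ).symm x') : Matrix mm mm ℂ) * (u' k (scShift' d L mv kk r hL μ ((scShift' d L mv kk r hL μ).symm x')))ᴴ) (u' k ((scShift' d L mv kk r hL μ).symm x') * (U' μ ((scShift' d L mv kk r hL μ).symm x') : Matrix mm mm ℂ) * (u' k (scShift' d L mv kk r hL μ ((scShift' d L mv kk r hL μ).symm x')))ᴴ)ᴴ)) 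-
      ((((((L ^ kk : ℕ) : ℝ))⁻¹))⁻¹ * (((((L ^ kk : ℕ) : ℝ))⁻¹))⁻¹) • (coordMat e (ContinuousLinearMap.mulLeftRight ℝ (Matrix mm mm ℂ) (u' k (kingSec (cvM d L mv kk hL) L kk r (kingPr L kk r (cvM d L mv kk hL) x')) * mprod (fun t => (U' μ (kingSec (cvM d L mv kk hL) L kk r (kingPr L kk r (cvM d L mv kk hL) x') + t • unitVec (fine (L ^ r * L ^ kk) (cvM d L mv kk hL)) μ) : Matrix mm mm ℂ)) (L ^ r) * (u' k (kingSec (cvM d L mv kk hL) L kk r (scShift d L mv kk hL μ (kingPr L kk r (cvM d L mv kk hL) x'))))ᴴ) (u' k (kingSec (cvM d L mv kk hL) L kk r (kingPr L kk r (cvM d L mv kk hL) x')) * mprod (fun t => (U' μ (kingSec (cvM d L mv kk hL) L kk r (kingPr L kk r (cvM d L mv kk hL) x') + t • unitVec (fine (L ^ r * L ^ kk) (cvM d L mv kk hL)) μ) : Matrix mm mm ℂ)) (L ^ r) * (u' k (kingSec (cvM d L mv kk hL) L kk r (scShift d L mv kk hL μ (kingPr L kk r (cvM d L mv kk hL) x'))))ᴴ)ᴴ)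 - coordMat e (ContinuousLinearMap.mulLeftRight ℝ (Matrix mm mm ℂ) (u' k (kingSec (cvM d L mv kk hL) L kk r ((scShift d L mv kk hL μ).symm (kingPr L kk r (cvM d L mv kk hL) x'))) * mprod (fun t => (U' μ (kingSec (cvM d L mv kk hL) L kk r ((scShift d L mv kk hL μ).symm (kingPr L kk r (cvM d L mv kk hL) x')) + t • unitVec (fine (L ^ r * L ^ kk) (cvM d L mv kk hL)) μ) : Matrix mm mm ℂ)) (L ^ r) * (u' k (kingSec (cvM d L mv kk hL) L kk r (scShift d L mv kk hL μ ((scShift d L mv kk hL μ).symm (kingPr L kk r (cvM d L mv kk hL) x')))))ᴴ) (u' k (kingSec (cvM d L mv kk hL) L kk r ((scShift d L mv kk hL μ).symm (kingPr L kk r (cvM d L mv kk hL) x'))) * mprod (fun t => (U' μ (kingSec (cvM d L mv kk hL) L kk r ((scShift d L mv kk hL μ).symm (kingPr L kk r (cvM d L mv kk hL) x')) + t • unitVec (fine (L ^ r * L ^ kk) (cvM d L mv kk hL)) μ) : Matrix mm mm ℂ)) (L ^ r) * (u' k (kingSec (cvM d L mv kk hL) L kk r (scShift d L mv kk hL μ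 ((scShift d L mv kk hL μ).symm (kingPr L kk r (cvM d L mv kk hL) x')))))ᴴ)ᴴ))) i j| ≤ oB := fun k μ x' hχ i j =>
    (sc_hB_of_pairwiseLetters hM hm₁ hfitI hS0 e u' hu' (fun μ z => (U' μ z : Matrix mm mm ℂ)) hU' (fun μ y => mprod (fun t => (U' μ (kingSec (cvM d L mv kk hL) L kk r y + t • unitVec (fine (L ^ r * L ^ kk) (cvM d L mv kk hL)) μ) : Matrix mm mm ℂ)) (L ^ r)) (fun μ y => rfl)
      hpf0 hqf0 hGf0 hF1f hstep hHf k μ x' hχ i j).trans hBle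
  have hfitC := sc_hfitC_of_pairing e he u' hu' (fun μ z => (U' μ z : Matrix mm mm ℂ)) hU' (fun μ y => mprod (fun t => (U' μ (kingSec (cvM d L mv kk hL) L kk r y + t • unitVec (fine (L ^ r * L ^ kk) (cvM d L mv kk hL)) μ) : Matrix mm mm ℂ)) (L ^ r)) hU (fun μ y => rfl) (fun k => {z : ScX' d L mv kk r hL | ∃ y ∈ cvSk d L mv kk hL k, (unitTorusGeo L kk (cvM d L mv kk hL)).dist (scBlk' d L mv kk r hL z) y ≤ 3}) hp hΩ0 hoB (fun k μ z hz => (hF1f k μ z hz).trans (mul_le_mul_of_nonneg_left hpf_le hη'.le)) hQlC hΩ hB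
  -- the cut Gram perturbation defect PRODUCED (n15-c∕352)
  have hd0 : ∀ k (z : ScX' d L mv kk r hL), scBlk' d L mv kk r hL z ∈ cvSk d L mv kk hL k → ∃ y ∈ cvSk d L mv kk hL k, (unitTorusGeo L kk (cvM d L mv kk hL)).dist (scBlk' d L mv kk r hL z) y ≤ 3 := fun k z hz =>
    ⟨_, hz, (le_of_eq (tdistT_self _ _)).trans (by norm_num)⟩
  have hON : (0 : ℝ) ≤ (Fintype.card ι * (|aK a₀ (L : ℝ) (r + kk) - aK a₀ (L : ℝ) kk| * (1 + Fintype.card ι) + |aK a₀ (L : ℝ) kk| * (2 * Fintype.card ι * (@basisConst ι _ (Matrix mm mm ℂ) Matrix.frobeniusNormedAddCommGroup Matrix.frobeniusNormedSpace e * (2 * Real.sqrt (Fintype.card mm)) * (Real.sqrt (Fintype.card mm) * ((d + 1) * (d * ((((L ^ r * L ^ kk : ℕ) : ℝ)) * (((L ^ r : ℕ) : ℝ) * (((((L ^ r * L ^ kk : ℕ) : ℝ))⁻¹) ^ 2 * ((C / ξ ^ 2) * Real.exp (((((L ^ r * L ^ kk : ℕ) : ℝ))⁻¹) * (C / ξ))))))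 + ((1 + (((((L ^ r * L ^ kk : ℕ) : ℝ))⁻¹) * ((C / ξ) * Real.exp (((((L ^ r * L ^ kk : ℕ) : ℝ))⁻¹) * (C / ξ))))) ^ (L ^ r) - 1)))))))) := by
    have hE : (0 : ℝ) ≤ (1 + (((((L ^ r * L ^ kk : ℕ) : ℝ))⁻¹) * ((C / ξ) * Real.exp (((((L ^ r * L ^ kk : ℕ) : ℝ))⁻¹) * (C / ξ))))) ^ (L ^ r) - 1 := by
      have := one_le_pow₀ (M₀ := ℝ) (a := 1 + (((((L ^ r * L ^ kk : ℕ) : ℝ))⁻¹) * ((C / ξ) * Real.exp (((((L ^ r * L ^ kk : ℕ) : ℝ))⁻¹) * (C / ξ))))) (by nlinarith [mul_nonneg hη'.le hpf0]) (n := L ^ r); linarith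
    have := @basisConst_nonneg ι _ (Matrix mm mm ℂ) Matrix.frobeniusNormedAddCommGroup Matrix.frobeniusNormedSpace e
    positivity
  have hDNV := fun k => hasMaj_idef_scNV_pairing ι e he a₀ u' hu' (fun μ z => (U' μ z : Matrix mm mm ℂ)) hU' (fun μ y => mprod (fun t => (U' μ (kingSec (cvM d L mv kk hL) L kk r y + t • unitVec (fine (L ^ r * L ^ kk) (cvM d L mv kk hL)) μ) : Matrix mm mm ℂ)) (L ^ r)) (fun μ y => rfl) (ρ := (((((L ^ r * L ^ kk : ℕ) : ℝ))⁻¹) * ((C / ξ) * Real.exp (((((L ^ r * L ^ kk : ℕ) : ℝ))⁻¹) * (C / ξ))))) (b := (((((L ^ r * L ^ kk : ℕ) : ℝ))⁻¹) ^ 2 * ((C / ξ ^ 2) * Real.exp (((((L ^ r * L ^ kk : ℕ) : ℝ))⁻¹) * (C / ξ))))) (mul_nonneg hη'.le hpf0) hb0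
    (fun k μ z hz => hF1f k μ z (hd0 k z hz)) (fun k κ μ z hz => hstep k κ μ z (hd0 k z hz)) δ k
  -- (J) the transporter letters' pairing fit on the cube's blocks (n15-c∕415), from the line memberships and the forward oscillation under block membership
  have hQlD : ∀ k (x' : ScX' d L mv kk r hL), scBlk d L mv kk hL (kingPr L kk r (cvM d L mv kk hL) x') ∈ cvSk d L mv kk hL k → ∀ t, t < L ^ r →
      kingSec (cvM d L mv kk hL) L kk r (kingPr L kk r (cvM d L mv kk hL) x') + t • unitVec (fine (L ^ r * L ^ kk) (cvM d L mv kk hL)) μ₀ ∈ (fun k => {z : ScX' d L mv kk r hL | ∃ y ∈ cvSk d L mv kk hL k, (unitTorusGeo L kk (cvM d L mv kk hL)).dist (scBlk' d L mv kk r hL z) y ≤ 3}) k := fun k x' hx t ht => by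
    have ha := hline k μ₀ _ ⟨_, hx, (le_of_eq (tdistT_self _ _)).trans zero_le_one⟩ t ht 0 (Nat.zero_le _)
    rw [zero_smul, sub_zero] at ha
    exact ha
  have hΩD := sc_hΩfwd_of_stepLetters_of_mem u' (fun μ z => (U' μ z : Matrix mm mm ℂ)) hb0 hstep μ₀
  have hfitD := sc_hfitD_of_pairing e he u' hu' (fun μ z => (U' μ z : Matrix mm mm ℂ)) hU' (fun μ y => mprod (fun t => (U' μ (kingSec (cvM d L mv kk hL) L kk r y + t • unitVec (fine (L ^ r * L ^ kk) (cvM d L mv kk hL)) μ) : Matrix mm mm ℂ)) (L ^ r)) (fun μ y => rfl) μ₀ (fun k => {z : ScX' d L mv kk r hL | ∃ y ∈ cvSk d L mv kk hL k, (unitTorusGeo L kk (cvM d L mv kk hL)).dist (scBlk' d L mv kk r hL z) y ≤ 3}) hp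
    (fun k μ z hz => (hF1f k μ z hz).trans (mul_le_mul_of_nonneg_left hpf_le hη'.le)) hQlD hΩD
  have hmain := H mv kk r hk hr hw₀' e he u' hu' (fun μ y => mprod (fun t => (U' μ (kingSec (cvM d L mv kk hL) L kk r y + t • unitVec (fine (L ^ r * L ^ kk) (cvM d L mv kk hL)) μ) : Matrix mm mm ℂ)) (L ^ r)) hU (fun μ z => (U' μ z : Matrix mm mm ℂ)) hU' (fun k => {z : ScX' d L mv kk r hL | ∃ y ∈ cvSk d L mv kk hL k, (unitTorusGeo L kk (cvM d L mv kk hL)).dist (scBlk' d L mv kk r hL z) y ≤ 3}) (fun k => {x : ScX d L mv kk hL | ∃ y ∈ cvSk d L mv kk hL k, (unitTorusGeo L kk (cvM d L mv kk hL)).dist (scBlk d L mv kk hL x) y ≤ 1}) (((1 + ((((L ^ r * L ^ kk : ℕ) : ℝ))⁻¹) * ((C / ξ) * Real.exp (((((L ^ r * L ^ kk : ℕ) : ℝ))⁻¹) * (C / ξ)))) ^ (L ^ r) - 1) / ((((L ^ kk : ℕ) : ℝ))⁻¹)) (((C / ξ ^ 2) * Real.exp (((((L ^ r * L ^ kk :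 ℕ) : ℝ))⁻¹) * (C / ξ))) * (1 + ((((L ^ r * L ^ kk : ℕ) : ℝ))⁻¹) * ((C / ξ) * Real.exp (((((L ^ r * L ^ kk : ℕ) : ℝ))⁻¹) * (C / ξ)))) ^ (L ^ r)) hp hq
    (fun k x' hx => ⟨⟨_, scBlk_kingPr_mem_cvSk_of_scChi'_ne_zero hM hm₁ hfitI hS0 hx, by rw [hblk x']; exact (le_of_eq (tdistT_self _ _)).trans (by norm_num)⟩, fun μ =>
      hmono k _ (0 + 1) (by norm_num) (exists_tdist_le_succ (tdist_scBlk'_scShift'_symm_le μ x') ⟨_, scBlk_kingPr_mem_cvSk_of_scChi'_ne_zero hM hm₁ hfitI hS0 hx, by rw [hblk x']; exact le_of_eq (tdistT_self _ _)⟩)⟩)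
    (fun k y' hy => ⟨_, hy, (le_of_eq (tdistT_self _ _)).trans (by norm_num)⟩)
    (fun k x hx => hcut k x hx) (fun k x hx => ⟨_, hx, (le_of_eq (tdistT_self _ _)).trans zero_le_one⟩)
    (fun k μ z hz => (hF1f k μ z hz).trans (mul_le_mul_of_nonneg_left hpf_le hη'.le))
    (fun k μ z hz => (hF2f k μ z hz).trans (mul_le_mul_of_nonneg_left hqf_le (sq_nonneg _)))
    (fun k μ x hx => (hC k μ x hx).1) (fun k μ x hx => (hC k μ x hx).2)
    rV oV (Fintype.card ι * (|aK a₀ (L : ℝ) (r + kk) - aK a₀ (L : ℝ) kk| * (1 + Fintype.card ι) + |aK a₀ (L : ℝ) kk| * (2 * Fintype.card ι * (@basisConst ι _ (Matrix mm mm ℂ) Matrix.frobeniusNormedAddCommGroup Matrix.frobeniusNormedSpace e * (2 * Real.sqrt (Fintype.card mm)) * (Real.sqrt (Fintype.card mm) * ((d + 1) * (d * ((((L ^ r * L ^ kk : ℕ) : ℝ)) * (((L ^ r : ℕ) : ℝ) * (((((L ^ r * L ^ kk : ℕ) : ℝ))⁻¹) ^ 2 * ((C / ξ ^ 2) * Real.exp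 (((((L ^ r * L ^ kk : ℕ) : ℝ))⁻¹) * (C / ξ)))))) + ((1 + (((((L ^ r * L ^ kk : ℕ) : ℝ))⁻¹) * ((C / ξ) * Real.exp (((((L ^ r * L ^ kk : ℕ) : ℝ))⁻¹) * (C / ξ))))) ^ (L ^ r) - 1)))))))) o hrV hoV hON hrA hrC (hRle.trans ((min_le_left _ _).trans (min_le_left _ _))) hole (hrA.trans hrV1) oa hoa0 (fun k x' hx i => (hfitD k x' hx i).trans hoD)
    (fun k x' i => (hfitC k x' i).trans hoC) (fun k j' x' i => (hfitA k j' x' i).trans hoA) hDNV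
  -- (PC-E-J-N): the SAME gauges give two-sided inverses on both grids (n15-c∕387) ⇒ the glued operators ARE the named Green's functions (n15-c∕388); the rewrite acts under `D′∘`, `D∘`
  obtain ⟨⟨-, hc1, hc2⟩, ⟨-, hf1, hf2⟩⟩ := HS mv kk r hk hr hw₀A e he u' hu' (fun μ y => mprod (fun t => (U' μ (kingSec (cvM d L mv kk hL) L kk r y + t • unitVec (fine (L ^ r * L ^ kk) (cvM d L mv kk hL)) μ) : Matrix mm mm ℂ)) (L ^ r)) hU (fun μ z => (U' μ z : Matrix mm mm ℂ)) hU' (fun k => {z : ScX' d L mv kk r hL | ∃ y ∈ cvSk d L mv kk hL k, (unitTorusGeo L kk (cvM d L mv kk hL)).dist (scBlk' d L mv kk r hL z) y ≤ 3}) (fun k => {x : ScX d L mv kk hL | ∃ y ∈ cvSk d L mv kk hL k, (unitTorusGeo L kk (cvM d L mv kk hL)).dist (scBlk d L mv kk hL x) y ≤ 1}) (((1 + ((((L ^ r * L ^ kk : ℕ) : ℝ))⁻¹) * ((C / ξ) * Real.exp (((((L ^ r * L ^ kk : ℕ) : ℝ))⁻¹) * (C / ξ)))) ^ (L ^ r)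 - 1) / ((((L ^ kk : ℕ) : ℝ))⁻¹)) (((C / ξ ^ 2) * Real.exp (((((L ^ r * L ^ kk : ℕ) : ℝ))⁻¹) * (C / ξ))) * (1 + ((((L ^ r * L ^ kk : ℕ) : ℝ))⁻¹) * ((C / ξ) * Real.exp (((((L ^ r * L ^ kk : ℕ) : ℝ))⁻¹) * (C / ξ)))) ^ (L ^ r)) hp hq (fun k x' hx => ⟨⟨_, scBlk_kingPr_mem_cvSk_of_scChi'_ne_zero hM hm₁ hfitI hS0 hx, by rw [hblk x']; exact (le_of_eq (tdistT_self _ _)).trans (by norm_num)⟩, fun μ =>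
      hmono k _ (0 + 1) (by norm_num) (exists_tdist_le_succ (tdist_scBlk'_scShift'_symm_le μ x') ⟨_, scBlk_kingPr_mem_cvSk_of_scChi'_ne_zero hM hm₁ hfitI hS0 hx, by rw [hblk x']; exact le_of_eq (tdistT_self _ _)⟩)⟩) (fun k x hx => hcut k x hx) (fun k μ z hz => (hF1f k μ z hz).trans (mul_le_mul_of_nonneg_left hpf_le hη'.le)) (fun k μ z hz => (hF2f k μ z hz).trans (mul_le_mul_of_nonneg_left hqf_le (sq_nonneg _))) (fun k μ x hx => (hC k μ x hx).1) (fun k μ x hx => (hC k μ x hx).2) rV hrV hrA hrC (hRle.trans ((min_le_left _ _).trans (min_le_right _ _)))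
  rw [eq_scGreenOp'_of_inverse e _ hf1 hf2, eq_scGreenOp_of_inverse e _ hc1 hc2] at hmain
  exact hmain

end Final

end Summit.QuantumFields.YangMills.BalabanUVNodes.N15.Gluing

end
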